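import Summits.CriticalPhenomena.CardyFormulaZ2.Theses.DyadicBetaRigidity
import Summits.CriticalPhenomena.CardyFormulaZ2.Theses.CardyExpCovariance
import Summits.CriticalPhenomena.CardyFormulaZ2.Theorems.DyadicBetaRigidityDyadicBetaSufficesDilation
import Summits.CriticalPhenomena.CardyFormulaZ2.Theorems.DyadicBetaRigidityDyadicLatticeBetaLawOfComparison
import Summits.CriticalPhenomena.CardyFormulaZ2.Theorems.CardyWhiteToColouredSimilarityUpgradeStubRectangleFamily
import Literature.Probability.RandomPlanarGeometry.RectangleModulusAspectRatio
import Literature.Probability.RandomPlanarGeometry.ImageUnivalent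
import Literature.Probability.RandomPlanarGeometry.ConformalRectangleProofs

/-!
# Subsequential conformal invariance implies the hard stub S1 of line `Sketch`

Crux `DyadicLatticeBetaLaw` (stmt-CriticalPhenomena-18183, route `DyadicBetaRigidity` of
`CardyFormulaZ2`), line `Sketch` (skeleton `Cruxes/DyadicLatticeBetaLaw/Lines/Sketch.lean`).
The line is kernel-reduced to its hard stub S1 `stub_equicontinuousComparison` (equicontinuous
equimodular comparison of lattice polygons along the dyadic ladders) and the external sequential
rigidity item (stmt-CriticalPhenomena-4680). This file identifies S1 FROM ABOVE with an existing
item of a neighbouring route: the target `CardyExpCovariance.SubseqConformalInvariance`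
(stmt-CriticalPhenomena-4678: every mesh sequence `u → 0⁺` has a subsequence along which the
bond-`ℤ²` crossing probabilities of ALL conformal rectangles converge to a function `f` of the
modulus) implies S1 — with NO rigidity and NO continuity hypothesis on `f`
(registered support stub `stub_equicontinuousComparison_of_subseqCI`).

Proof. Fix `ε > 0`, `η ∈ (0,1)`. Let `Q w` be the corner-marked boxes `(0,w) × (0,1)` crossed
left-to-right (`RectangleFamily`), whose modulus is a strictly decreasing function `ηB w` of the
width onto `(0,1)` (`rectangle_crossRatio_eq_of_aspectRatio_holds`); pick `w₀` with `ηB w₀ = η`.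
Mesh-uniform local equicontinuity of the box crossings in the width (`RectSubseqLimits.lr_local`,
from `crossingProb_uniformIncrement`) gives `ρ` with `|P[Q w₁, 1/m] - P[Q w₀, 1/m]| ≤ ε/4` for
`|w₁ - w₀| < ρ` and all large `m`; strict antitonicity turns `ρ` into a modulus window
`θ = min (η - ηB (w₀ + ρ/2)) (ηB (w₀ - ρ/2) - η)`: every `η₁ ∈ (0,1)` with `|η₁ - η| < θ` is
`ηB w₁` for some `w₁ ∈ (w₀ - ρ, w₀ + ρ)`. Now let `R, R'` (ANY conformal rectangles — the lattice
hypotheses of S1 are not used) have moduli `θ`-close to `η` and suppose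
`|P[R, h/2^k] - P[R', h'/2^k]| ≥ ε` for infinitely many `k`, say along `k_i`. Along
`u_i = h/2^{k_i}` the hypothesis gives a subsequence `ψ` and `f` with `P[S, u_{ψ n}] → f(η_S)` for
every `S`; by exact dilation covariance (`bondDomainCrossingProb_dilate'`)
`P[R', h'/2^{k_{ψ n}}] = P[(h/h') R', u_{ψ n}] → f(η_{R'})`. Along the fitted meshes
`1/⌊1/u_{ψ n}⌋₊` every box has the same limit (`JointLimit.tendsto_fitted`, the tree's
`scaleContinuity`), so `|f(η_R) - f(η)| ≤ ε/4` and `|f(η_{R'}) - f(η)| ≤ ε/4` by the window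
(`η_R = ηB w_R`, `f(ηB w) = lim P[Q w, ·]`); hence
`|P[R, h/2^{k_{ψ n}}] - P[R', h'/2^{k_{ψ n}}]| → |f(η_R) - f(η_{R'})| ≤ ε/2 < ε`, a contradiction.

Consequence (with the landed composition `crux_of_comparison_of_rigiditySeq`): the crux follows
from the two CardyExpCovariance items stmt-4678 and stmt-4680 through THIS line, and S1 sits
between them and the crux: `SubseqConformalInvariance ⇒ S1`, `S1 ∧ CardyRigiditySeq ⇒ crux ⇒ S1`.

References: B. Bollobás, O. Riordan, *Percolation* (2006), Ch. 7 §7.1 (moduli of rectangles,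
pp. 183–185); O. Schramm, S. Smirnov, Ann. Probab. 39 (2011), Lemma 6.1 (RSW equicontinuity).
-/

noncomputable section

open MeasureTheory Filter Set Metric Topology
open UpperHalfPlane (upperHalfPlaneSet)
open Literature.Probability.RandomPlanarGeometry Literature.Probability.LatticeModels
open Literature.Probability.Percolation
open Summit.CriticalPhenomena.CardyFormulaZ2.Theorems
open Summit.CriticalPhenomena.CardyFormulaZ2.Cruxes.SimilarityUpgrade.Stubs (RectangleFamily.exists_shift3
  RectangleFamily.lr_family RectangleFamily.lr_pt)
open Summit.CriticalPhenomena.CardyFormulaZ2.Cruxes.SubseqCardy.Birth (JointLimit.tendsto_fitted)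

namespace Summit.CriticalPhenomena.CardyFormulaZ2.Cruxes.DyadicLatticeBetaLaw.Stubs

namespace S1OfSubseqCI

/-- **The corner-marked left-to-right boxes** `(0,w) × (0,1)`, marks `i, 0, w, w + i`, arcs
`0` = left side, `2` = right side (the tree's `RectangleFamily`: `rectQuad 0 w 0 1` re-marked by
three). [folklore] -/
theorem exists_lrBoxFamily : ∃ Q : ℝ → ConformalRectangle,
    (∀ w : ℝ, 0 < w → (Q w).carrier = (Ioo (0 : ℝ) w ×ℂ Ioo (0 : ℝ) 1) ∧
      (Q w).arc 0 = {z : ℂ | z.re = 0 ∧ z.im ∈ Icc (0 : ℝ) 1} ∧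
      (Q w).arc 2 = {z : ℂ | z.re = w ∧ z.im ∈ Icc (0 : ℝ) 1}) ∧
    (∀ w : ℝ, 0 < w → (Q w).pt 0 = Complex.I ∧ (Q w).pt 1 = 0 ∧ (Q w).pt 2 = (w : ℂ) ∧
      (Q w).pt 3 = (w : ℂ) + Complex.I) := by
  choose sh hsh using RectangleFamily.exists_shift3
  obtain ⟨Q', hQ'⟩ : ∃ Q' : ℝ → ConformalRectangle,
      ∀ (w : ℝ) (hw : 0 < w), Q' w = rectQuad 0 w 0 1 hw one_pos :=
    ⟨fun w => if h : 0 < w then rectQuad 0 w 0 1 h one_pos else rectQuad 0 1 0 1 one_pos one_pos,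
      fun w hw => dif_pos hw⟩
  exact ⟨fun w => sh (Q' w), RectangleFamily.lr_family sh hsh Q' hQ',
    RectangleFamily.lr_pt sh hsh Q' hQ'⟩

/-- Along a mesh sequence `u → 0⁺`, the fitted integers `⌊1/u n⌋₊` tend to infinity. [folklore] -/
theorem tendsto_floor_inv {u : ℕ → ℝ} (hu : Tendsto u atTop (𝓝[>] (0 : ℝ))) :
    Tendsto (fun n => ⌊1 / u n⌋₊) atTop atTop := by
  have h1 : Tendsto (fun n => 1 / u n) atTop atTop := by
    have h := tendsto_inv_nhdsGT_zero.comp hu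
    simpa only [one_div, Function.comp_def] using h
  exact tendsto_nat_floor_atTop.comp h1

end S1OfSubseqCI

open S1OfSubseqCI

/-- **`SubseqConformalInvariance → S1`** (registered support stub
`stub_equicontinuousComparison_of_subseqCI` of crux stmt-CriticalPhenomena-18183, line `Sketch`).
If every mesh sequence `u → 0⁺` has a subsequence along which the bond-`ℤ²` crossing
probabilities of all conformal rectangles converge to a function of the modulus
(`CardyExpCovariance.SubseqConformalInvariance`, stmt-CriticalPhenomena-4678), then for every
`ε > 0` and `η ∈ (0,1)` there is `θ > 0` such that two lattice polygons whose moduli are `θ`-close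
to `η` have crossing probabilities along their dyadic ladders `h/2^k`, `h'/2^k` eventually
`ε`-close (stub S1 `stub_equicontinuousComparison` verbatim). The modulus of continuity comes
from the mesh-uniform RSW equicontinuity of box crossings in the width and the strict monotonicity
of the modulus of a rectangle in its aspect ratio; the two ladders are tied by exact dilation
covariance. [cite: BollobasRiordan2006, Ch. 7 §7.1 pp. 183–185] -/
theorem stub_equicontinuousComparison_of_subseqCI :
    Summit.CriticalPhenomena.CardyFormulaZ2.Theses.CardyExpCovariance.SubseqConformalInvariance →
    ∀ ε : ℝ, 0 < ε → ∀ η ∈ Set.Ioo (0 : ℝ) 1, ∃ θ : ℝ, 0 < θ ∧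
      ∀ h h' : ℝ, 0 < h → 0 < h' → ∀ R R' : ConformalRectangle,
        (∃ S : Finset (ℂ × ℂ), (∀ p ∈ S, ∃ u v : Site 2, (zdGraph 2).Adj u v ∧
            p.1 = meshPoint h u ∧ p.2 = meshPoint h v) ∧
            frontier R.carrier ⊆ ⋃ p ∈ S, segment ℝ p.1 p.2) →
        (∃ S : Finset (ℂ × ℂ), (∀ p ∈ S, ∃ u v : Site 2, (zdGraph 2).Adj u v ∧
            p.1 = meshPoint h' u ∧ p.2 = meshPoint h' v) ∧
            frontier R'.carrier ⊆ ⋃ p ∈ S, segment ℝ p.1 p.2) →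
        ∀ (φ : ConformalEquiv upperHalfPlaneSet R.carrier) (x : Fin 4 → ℝ)
          (φ' : ConformalEquiv upperHalfPlaneSet R'.carrier) (x' : Fin 4 → ℝ),
          R.IsUniformizing φ x → R'.IsUniformizing φ' x' →
          |crossRatio x - η| < θ → |crossRatio x' - η| < θ →
          ∀ᶠ k : ℕ in atTop,
            |bondDomainCrossingProb R (h / 2 ^ k) - bondDomainCrossingProb R' (h' / 2 ^ k)| < ε := by
  intro hX ε hε η hη
  classical
  -- the left-to-right boxes and their moduli
  obtain ⟨Q, hQ, hQpt⟩ := exists_lrBoxFamily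
  obtain ⟨ηB, hanti, himage, hmod⟩ := rectangle_crossRatio_eq_of_aspectRatio_holds
  have hQmod : ∀ w : ℝ, 0 < w → ∀ (φ : ConformalEquiv upperHalfPlaneSet (Q w).carrier)
      (x : Fin 4 → ℝ), (Q w).IsUniformizing φ x → crossRatio x = ηB w := by
    intro w hw φ x hφ
    obtain ⟨h0, h1, h2, h3⟩ := hQpt w hw
    have e := hmod (Q w) w 1 hw one_pos (hQ w hw).1
      ⟨by rw [h0]; push_cast; ring, h1, h2, by rw [h3]; push_cast; ring⟩ φ x hφ
    rwa [div_one] at e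
  -- every modulus in `(0,1)` is the modulus of a box
  have hsurj : ∀ η₁ ∈ Ioo (0 : ℝ) 1, ∃ w₁ ∈ Ioi (0 : ℝ), ηB w₁ = η₁ := fun η₁ hη₁ => by
    have hmem : η₁ ∈ ηB '' Ioi 0 := by rw [himage]; exact hη₁
    exact hmem
  obtain ⟨w₀, hw₀, hw₀η⟩ := hsurj η hη
  have hw₀' : (0 : ℝ) < w₀ := hw₀
  -- mesh-uniform local equicontinuity of the box crossings at `w₀`, accuracy `ε/4`
  obtain ⟨ρ, hρ, hρw, K, hK⟩ :=
    RectSubseqLimits.lr_local hQ hw₀' (by positivity : (0 : ℝ) < ε / 4)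
  -- the modulus window `θ`
  have hwp : (0 : ℝ) < w₀ + ρ / 2 := by linarith
  have hwm : (0 : ℝ) < w₀ - ρ / 2 := by linarith
  have hltp : ηB (w₀ + ρ / 2) < η := by
    rw [← hw₀η]; exact hanti hw₀ (mem_Ioi.2 hwp) (by linarith)
  have hltm : η < ηB (w₀ - ρ / 2) := by
    rw [← hw₀η]; exact hanti (mem_Ioi.2 hwm) hw₀ (by linarith)
  refine ⟨min (η - ηB (w₀ + ρ / 2)) (ηB (w₀ - ρ / 2) - η), lt_min (by linarith) (by linarith), ?_⟩
  intro h h' hh hh' R R' _hR _hR' φ x φ' x' hφ hφ' hx hx'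
  -- windows: a modulus `θ`-close to `η` is the modulus of a box of width `ρ`-close to `w₀`
  have hwit : ∀ η₁ : ℝ, η₁ ∈ Ioo (0 : ℝ) 1 →
      |η₁ - η| < min (η - ηB (w₀ + ρ / 2)) (ηB (w₀ - ρ / 2) - η) →
      ∃ w₁ : ℝ, 0 < w₁ ∧ w₀ - ρ < w₁ ∧ w₁ < w₀ + ρ ∧ ηB w₁ = η₁ := by
    intro η₁ hη₁ h1
    obtain ⟨w₁, hw₁, hw₁η⟩ := hsurj η₁ hη₁
    have hw₁' : (0 : ℝ) < w₁ := hw₁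
    have h1' := abs_lt.1 h1
    have hθ1 := min_le_left (η - ηB (w₀ + ρ / 2)) (ηB (w₀ - ρ / 2) - η)
    have hθ2 := min_le_right (η - ηB (w₀ + ρ / 2)) (ηB (w₀ - ρ / 2) - η)
    refine ⟨w₁, hw₁', ?_, ?_, hw₁η⟩
    · by_contra hle
      push Not at hle
      have hlt : w₁ < w₀ - ρ / 2 := by linarith
      have : ηB (w₀ - ρ / 2) < ηB w₁ := hanti hw₁ (mem_Ioi.2 hwm) hlt
      linarith
    · by_contra hle
      push Not at hle
      have hlt : w₀ + ρ / 2 < w₁ := by linarith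
      have : ηB w₁ < ηB (w₀ + ρ / 2) := hanti (mem_Ioi.2 hwp) hw₁ hlt
      linarith
  have hηR := ConformalRectangle.crossRatio_mem_Ioo_of_isUniformizing hφ
  have hηR' := ConformalRectangle.crossRatio_mem_Ioo_of_isUniformizing hφ'
  obtain ⟨wR, hwR, hwR1, hwR2, hwRη⟩ := hwit _ hηR hx
  obtain ⟨wR', hwR', hwR'1, hwR'2, hwR'η⟩ := hwit _ hηR' hx'
  -- suppose the conclusion fails: a bad subsequence `kk`
  by_contra hne
  have hfreq : ∃ᶠ k : ℕ in atTop,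
      ε ≤ |bondDomainCrossingProb R (h / 2 ^ k) - bondDomainCrossingProb R' (h' / 2 ^ k)| :=
    (Filter.not_eventually.1 hne).mono fun k hk => not_lt.1 hk
  obtain ⟨kk, hkk, hbad⟩ := Filter.extraction_of_frequently_atTop hfreq
  -- the mesh sequence and its conformally invariant subsequential limit
  obtain ⟨u, hudef⟩ : ∃ u : ℕ → ℝ, ∀ i, u i = h / 2 ^ (kk i) := ⟨_, fun _ => rfl⟩
  have hu : Tendsto u atTop (𝓝[>] (0 : ℝ)) := by
    have e : u = fun i => h / 2 ^ (kk i) := funext hudef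
    rw [e]
    exact (tendsto_dyadicMesh' hh).comp hkk.tendsto_atTop
  obtain ⟨ψ, f, hψ, hf⟩ := hX u hu
  have huψ : Tendsto (fun n => u (ψ n)) atTop (𝓝[>] (0 : ℝ)) := hu.comp hψ.tendsto_atTop
  -- a joint limit `g` (choice of a uniformizing datum for every conformal rectangle)
  have hdat : ∀ S : ConformalRectangle,
      ∃ d : (ConformalEquiv upperHalfPlaneSet S.carrier) × (Fin 4 → ℝ),
        S.IsUniformizing d.1 d.2 := fun S => by
    obtain ⟨χ, y, hχ⟩ := MarkedDomain.exists_isUniformizing_holds S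
    exact ⟨⟨χ, y⟩, hχ⟩
  choose dat hdat using hdat
  obtain ⟨g, hgdef⟩ : ∃ g : ConformalRectangle → ℝ, ∀ S, g S = f (crossRatio (dat S).2) :=
    ⟨_, fun _ => rfl⟩
  have hg : ∀ S : ConformalRectangle,
      Tendsto (fun n => bondDomainCrossingProb S (u (ψ n))) atTop (𝓝 (g S)) := fun S => by
    rw [hgdef]
    exact hf S (dat S).1 (dat S).2 (hdat S)
  -- values of `g` on boxes
  have hgQ : ∀ w : ℝ, 0 < w → g (Q w) = f (ηB w) := fun w hw => by
    rw [hgdef, hQmod w hw _ _ (hdat (Q w))]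
  -- the limits of `R` and of `R'` along the bad ladder
  have hRlim : Tendsto (fun n => bondDomainCrossingProb R (h / 2 ^ (kk (ψ n)))) atTop
      (𝓝 (f (crossRatio x))) := by
    have hlim := hf R φ x hφ
    refine hlim.congr fun n => ?_
    rw [hudef]
  have hc : 0 < h / h' := div_pos hh hh'
  have hR'lim : Tendsto (fun n => bondDomainCrossingProb R' (h' / 2 ^ (kk (ψ n)))) atTop
      (𝓝 (f (crossRatio x'))) := by
    have hd := DyadicLattice.differentiableOn_mul_left ((h / h' : ℝ) : ℂ) (closure R'.carrier)
    have hi := DyadicLattice.injOn_mul_left (c := ((h / h' : ℝ) : ℂ)) (by exact_mod_cast hc.ne')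
      (closure R'.carrier)
    have hφ'' := hφ'.imageUnivalent hd hi
    have hlim := hf _ _ x' hφ''
    refine hlim.congr fun n => ?_
    have e : u (ψ n) = h / h' * (h' / 2 ^ (kk (ψ n))) := by
      rw [hudef]
      field_simp
    rw [e]
    exact DyadicLattice.bondDomainCrossingProb_dilate' R' hc _
  -- box comparison along the fitted meshes: `|g (Q w₁) - g (Q w₀)| ≤ ε/4` in the window
  have hfit : ∀ S : ConformalRectangle,
      Tendsto (fun n => bondDomainCrossingProb S (1 / (⌊1 / u (ψ n)⌋₊ : ℝ))) atTop (𝓝 (g S)) :=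
    fun S => JointLimit.tendsto_fitted huψ hg S
  have hM : Tendsto (fun n => ⌊1 / u (ψ n)⌋₊) atTop atTop := tendsto_floor_inv huψ
  have hwindow : ∀ w₁ : ℝ, w₀ - ρ < w₁ → w₁ < w₀ + ρ → |g (Q w₁) - g (Q w₀)| ≤ ε / 4 := by
    intro w₁ h1 h2
    have hev : ∀ᶠ n in atTop, K + 2 ≤ ⌊1 / u (ψ n)⌋₊ := hM.eventually (eventually_ge_atTop _)
    have hpt : ∀ᶠ n in atTop, |bondDomainCrossingProb (Q w₁) (1 / (⌊1 / u (ψ n)⌋₊ : ℝ)) -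
        bondDomainCrossingProb (Q w₀) (1 / (⌊1 / u (ψ n)⌋₊ : ℝ))| ≤ ε / 4 := by
      filter_upwards [hev] with n hn
      have hcast : (1 : ℝ) / (⌊1 / u (ψ n)⌋₊ : ℝ) = 1 / (((⌊1 / u (ψ n)⌋₊ - 2 : ℕ) : ℝ) + 2) := by
        rw [Nat.cast_sub (by omega : 2 ≤ ⌊1 / u (ψ n)⌋₊)]
        push_cast
        ring_nf
      rw [hcast]
      have hKk : K ≤ ⌊1 / u (ψ n)⌋₊ - 2 := by omega
      rcases le_total w₁ w₀ with hle | hle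
      · obtain ⟨ha, hb⟩ := hK _ hKk w₁ w₀ h1 hle (by linarith)
        rw [abs_le]; constructor <;> linarith
      · obtain ⟨ha, hb⟩ := hK _ hKk w₀ w₁ (by linarith) hle h2
        rw [abs_le]; constructor <;> linarith
    exact le_of_tendsto ((hfit (Q w₁)).sub (hfit (Q w₀))).abs hpt
  -- the bad ladder converges to `f η_R - f η_R'`, of absolute value `≤ ε/2`
  have hgap : |f (crossRatio x) - f (crossRatio x')| ≤ ε / 2 := by
    have e1 : f (crossRatio x) = g (Q wR) := by rw [hgQ wR hwR, hwRη]
    have e2 : f (crossRatio x') = g (Q wR') := by rw [hgQ wR' hwR', hwR'η]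
    have b1 := hwindow wR hwR1 hwR2
    have b2 := hwindow wR' hwR'1 hwR'2
    rw [e1, e2]
    calc |g (Q wR) - g (Q wR')| = |(g (Q wR) - g (Q w₀)) - (g (Q wR') - g (Q w₀))| := by ring_nf
      _ ≤ |g (Q wR) - g (Q w₀)| + |g (Q wR') - g (Q w₀)| := abs_sub _ _
      _ ≤ ε / 2 := by linarith
  have hdlim : Tendsto (fun n => bondDomainCrossingProb R (h / 2 ^ (kk (ψ n))) -
      bondDomainCrossingProb R' (h' / 2 ^ (kk (ψ n)))) atTop
      (𝓝 (f (crossRatio x) - f (crossRatio x'))) := hRlim.sub hR'lim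
  have hεle : ε ≤ |f (crossRatio x) - f (crossRatio x')| :=
    ge_of_tendsto hdlim.abs (Eventually.of_forall fun n => hbad (ψ n))
  linarith

end Summit.CriticalPhenomena.CardyFormulaZ2.Cruxes.DyadicLatticeBetaLaw.Stubs

end
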